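import Literature.Topology.FourManifolds.LatticeFormsLengthTwist
import HarnessLib

/-!
# The discriminant form of `U(m)^{⊕ n}`: `q_{U(2)^{⊕3}}(x) = x₁x₂ + x₃x₄ + x₅x₆`

[cite: VanGeemenSarti2007, §1.10 (proof of Lemma 1.10)] [cite: Huybrechts2016K3, Ch. 14 §0.3 (ii), (iv)]

Van Geemen–Sarti, proof of Lemma 1.10: "Let `e, f` be the standard basis of `U`, so `e² = f² = 0`, `ef = 1`, then
`U(2)` has the same basis with `e² = f² = 0`, `ef = 2`. Thus `U(2)^*` has basis `e/2, f/2` with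
`(e/2)² = (f/2)² = 0`, `(e/2)(f/2) = 2/4 = 1/2`. Thus `A_K = (U(2)^*/U(2))³ ≅ (ℤ/2ℤ)⁶`, and the discriminant
form `q_K` on `A_K` is given by `q_K : A_K = (ℤ/2ℤ)⁶ → ℤ/2ℤ`, `q_K(x) = x₁x₂ + x₃x₄ + x₅x₆`."

In the `Λ^*`-model (`LatticeFormsDiscriminantForm.lean`, `LatticeFormsTwistDiscriminantGroup.lean`): for
`K = U(m)^{⊕ n} = m • hyperbolicSum n` on `ℤⁿ × ℤⁿ` (`e`- and `f`-coordinates) the class of the "vector divided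
by `m`" `w/m`, `w = (u, v) ∈ U^{⊕ n}`, is `[hyperbolicSum n w] = ι[w] ∈ A_K` (`twistIncl`), and
* `q_K(w/m) = 2(u·v)/m mod 2ℤ` (`discriminantQuad_smul_hyperbolicSum_mk`); for `m = 2`: `q_K(w/2) = u·v mod 2ℤ`,
  i.e. `Σ xᵢyᵢ ∈ ℤ/2ℤ` in the residues `x = u mod 2`, `y = v mod 2` (`discriminantQuad_two_smul_hyperbolicSum_mk`,
  `…_eq_zero_iff`: `q = 0 ↔ 2 ∣ u·v`);
* `b_K(eᵢ/2, fⱼ/2) = δᵢⱼ/2`, `b_K(eᵢ/2, eⱼ/2) = b_K(fᵢ/2, fⱼ/2) = 0` (`dualForm_two_smul_hyperbolicSum_…`).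
(`A_{U(m)^{⊕ n}} ≅ (ℤ/m)^{2n}` itself is `discriminantGroupSmulHyperbolicSumEquiv` of `LatticeFormsLengthTwist.lean`;
the one-copy case `q_{U(m)}` is `discriminantQuad_smul_hyperbolicForm_mk`.)
-/

noncomputable section

open Module Function Matrix

namespace LinearMap.BilinForm

section Examples

variable (m : ℤ) (n : ℕ)

/-- `(w . w)_{U^{⊕n}} = 2 u·v` for `w = (u, v)`. [cite: VanGeemenSarti2007, §1.10 ("`e² = f² = 0`, `ef = 1`")] -/
theorem hyperbolicSum_apply_self (w : (Fin n → ℤ) × (Fin n → ℤ)) : hyperbolicSum n w w = 2 * (w.1 ⬝ᵥ w.2) := by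
  rw [hyperbolicSum_apply, dotProduct_comm w.2, two_mul]

/-- `U(m)^{⊕ n}` is symmetric. [cite: Huybrechts2016K3, Ch. 14 §0.3 (ii), (iv)] -/
theorem isSymm_smul_hyperbolicSum : (m • hyperbolicSum n).IsSymm :=
  (hyperbolicSum n).isSymm_smul_of_isSymm m (isSymm_hyperbolicSum n)

/-- `U(m)^{⊕ n}` is even. [cite: Huybrechts2016K3, Ch. 14 §0.3 (ii), (iv)] -/
theorem isEven_smul_hyperbolicSum : (m • hyperbolicSum n).IsEven := fun w ↦
  ⟨m * (w.1 ⬝ᵥ w.2), by rw [smul_apply_apply, hyperbolicSum_apply_self]; ring⟩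

/-- `U(m)^{⊕ n}` is nondegenerate for `m ≠ 0`. [cite: Huybrechts2016K3, Ch. 14 §0.3 (iv)] -/
theorem nondegenerate_smul_hyperbolicSum (hm : m ≠ 0) : (m • hyperbolicSum n).Nondegenerate :=
  ((hyperbolicSum n).nondegenerate_zsmul_iff hm).2 (isUnimodular_hyperbolicSum n).nondegenerate

/-- **`q_{U(m)^{⊕n}}(w/m) = (w . w)/m = 2(u·v)/m mod 2ℤ`** for `w = (u, v) ∈ U^{⊕ n}` (the class `ι[w] = [(w . _)_U]`).
[cite: Huybrechts2016K3, Ch. 14 §0.3 (iv)] [cite: VanGeemenSarti2007, §1.10] -/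
theorem discriminantQuad_smul_hyperbolicSum_mk (hm : m ≠ 0) (h₁ : (m • hyperbolicSum n).Nondegenerate)
    (h₂ : (m • hyperbolicSum n).IsSymm) (h₃ : (m • hyperbolicSum n).IsEven) (w : (Fin n → ℤ) × (Fin n → ℤ)) :
    (m • hyperbolicSum n).discriminantQuad h₁ h₂ h₃ (Submodule.Quotient.mk (hyperbolicSum n w)) =
      (((2 * (w.1 ⬝ᵥ w.2 : ℤ) : ℚ) / m : ℚ) : AddCircle (2 : ℚ)) := by
  have h := (hyperbolicSum n).discriminantQuad_smul_twistIncl_mk m (isUnimodular_hyperbolicSum n).nondegenerate hm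
    h₁ h₂ h₃ w
  rw [twistIncl_mk, hyperbolicSum_apply_self] at h
  rw [h]
  norm_cast

/-- **`q_{U(2)^{⊕n}}(w/2) = u·v mod 2ℤ`** ("`q_K(x) = x₁x₂ + x₃x₄ + x₅x₆`" for `n = 3`, in the residues
`xᵢ ↔ (uᵢ, vᵢ) mod 2`). [cite: VanGeemenSarti2007, §1.10 (proof of Lemma 1.10)] -/
theorem discriminantQuad_two_smul_hyperbolicSum_mk (h₁ : ((2 : ℤ) • hyperbolicSum n).Nondegenerate)
    (h₂ : ((2 : ℤ) • hyperbolicSum n).IsSymm) (h₃ : ((2 : ℤ) • hyperbolicSum n).IsEven) (w : (Fin n → ℤ) × (Fin n → ℤ)) :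
    ((2 : ℤ) • hyperbolicSum n).discriminantQuad h₁ h₂ h₃ (Submodule.Quotient.mk (hyperbolicSum n w)) =
      (((w.1 ⬝ᵥ w.2 : ℤ) : ℚ) : AddCircle (2 : ℚ)) := by
  rw [discriminantQuad_smul_hyperbolicSum_mk 2 n two_ne_zero]
  congr 1
  push_cast
  ring

/-- **`q_{U(2)^{⊕n}}` takes values in `ℤ/2ℤ ⊂ ℚ/2ℤ`: `q(w/2) = 0 ↔ u·v` even** (and otherwise `q(w/2) = 1`).
[cite: VanGeemenSarti2007, §1.10 ("`q_K : A_K = (ℤ/2ℤ)⁶ → ℤ/2ℤ`")] -/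
theorem discriminantQuad_two_smul_hyperbolicSum_mk_eq_zero_iff (h₁ : ((2 : ℤ) • hyperbolicSum n).Nondegenerate)
    (h₂ : ((2 : ℤ) • hyperbolicSum n).IsSymm) (h₃ : ((2 : ℤ) • hyperbolicSum n).IsEven) (w : (Fin n → ℤ) × (Fin n → ℤ)) :
    ((2 : ℤ) • hyperbolicSum n).discriminantQuad h₁ h₂ h₃ (Submodule.Quotient.mk (hyperbolicSum n w)) = 0 ↔
      (2 : ℤ) ∣ w.1 ⬝ᵥ w.2 := by
  rw [discriminantQuad_two_smul_hyperbolicSum_mk, AddCircle.coe_eq_zero_iff]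
  constructor
  · rintro ⟨k, hk⟩
    rw [zsmul_eq_mul] at hk
    exact ⟨k, Int.cast_injective (α := ℚ) (by push_cast; linarith)⟩
  · rintro ⟨k, hk⟩
    exact ⟨k, by rw [zsmul_eq_mul, hk]; push_cast; ring⟩

/-- `q_{U(2)^{⊕n}}(w/2) = 1 mod 2ℤ ↔ u·v` odd. [cite: VanGeemenSarti2007, §1.10] -/
theorem discriminantQuad_two_smul_hyperbolicSum_mk_eq_one_iff (h₁ : ((2 : ℤ) • hyperbolicSum n).Nondegenerate)
    (h₂ : ((2 : ℤ) • hyperbolicSum n).IsSymm) (h₃ : ((2 : ℤ) • hyperbolicSum n).IsEven) (w : (Fin n → ℤ) × (Fin n → ℤ)) :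
    ((2 : ℤ) • hyperbolicSum n).discriminantQuad h₁ h₂ h₃ (Submodule.Quotient.mk (hyperbolicSum n w)) =
        ((1 : ℚ) : AddCircle (2 : ℚ)) ↔ ¬(2 : ℤ) ∣ w.1 ⬝ᵥ w.2 := by
  rw [discriminantQuad_two_smul_hyperbolicSum_mk, ← sub_eq_zero, ← AddCircle.coe_sub, AddCircle.coe_eq_zero_iff]
  constructor
  · rintro ⟨k, hk⟩ ⟨j, hj⟩
    rw [zsmul_eq_mul, hj] at hk
    push_cast at hk
    have : (2 * (k - j) : ℤ) = -1 := Int.cast_injective (α := ℚ) (by push_cast; linarith)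
    omega
  · intro h
    obtain ⟨j, hj⟩ : Odd (w.1 ⬝ᵥ w.2) := Int.not_even_iff_odd.1 (fun he ↦ h (even_iff_two_dvd.1 he))
    exact ⟨j, by rw [zsmul_eq_mul, hj]; push_cast; ring⟩

/-- **Every class of `A_{U(m)^{⊕n}}` is some `w/m`** (`A_{U(m)^{⊕n}} = ι(U^{⊕n}/mU^{⊕n})`).
[cite: Huybrechts2016K3, Ch. 14 §0.3 (iv)] -/
theorem exists_mk_hyperbolicSum_eq (a : (m • hyperbolicSum n).discriminantGroup) :
    ∃ w : (Fin n → ℤ) × (Fin n → ℤ), Submodule.Quotient.mk (hyperbolicSum n w) = a := by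
  obtain ⟨x, rfl⟩ := ((hyperbolicSum n).twistIncl_bijective_of_isUnimodular m (isUnimodular_hyperbolicSum n)).2 a
  obtain ⟨w, rfl⟩ := Submodule.Quotient.mk_surjective _ x
  exact ⟨w, ((hyperbolicSum n).twistIncl_mk m w).symm⟩

/-- **"`U(2)^*` has basis `e/2, f/2` with `(e/2)(f/2) = 1/2`"**: `b(eᵢ/2, fⱼ/2) = δᵢⱼ/2` (the functionals
`(eᵢ . _)_U = 2 · (eᵢ/2 . _)_{U(2)}`). [cite: VanGeemenSarti2007, §1.10 (proof of Lemma 1.10)] -/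
theorem dualForm_two_smul_hyperbolicSum_e_f (i j : Fin n) :
    ((2 : ℤ) • hyperbolicSum n).dualForm (hyperbolicSum n (Pi.single i 1, 0)) (hyperbolicSum n (0, Pi.single j 1)) =
      if i = j then 1 / 2 else 0 := by
  rw [(hyperbolicSum n).dualForm_smul_apply_apply 2 (isUnimodular_hyperbolicSum n).nondegenerate two_ne_zero,
    (isSymm_hyperbolicSum n).eq, hyperbolicSum_inl_inr]
  split_ifs <;> simp

/-- `(eᵢ/2)(eⱼ/2) = 0` ("`(e/2)² = 0`"). [cite: VanGeemenSarti2007, §1.10 (proof of Lemma 1.10)] -/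
theorem dualForm_two_smul_hyperbolicSum_e_e (i j : Fin n) :
    ((2 : ℤ) • hyperbolicSum n).dualForm (hyperbolicSum n (Pi.single i 1, 0)) (hyperbolicSum n (Pi.single j 1, 0)) = 0 := by
  rw [(hyperbolicSum n).dualForm_smul_apply_apply 2 (isUnimodular_hyperbolicSum n).nondegenerate two_ne_zero,
    hyperbolicSum_apply]
  simp

/-- `(fᵢ/2)(fⱼ/2) = 0` ("`(f/2)² = 0`"). [cite: VanGeemenSarti2007, §1.10 (proof of Lemma 1.10)] -/
theorem dualForm_two_smul_hyperbolicSum_f_f (i j : Fin n) :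
    ((2 : ℤ) • hyperbolicSum n).dualForm (hyperbolicSum n (0, Pi.single i 1)) (hyperbolicSum n (0, Pi.single j 1)) = 0 := by
  rw [(hyperbolicSum n).dualForm_smul_apply_apply 2 (isUnimodular_hyperbolicSum n).nondegenerate two_ne_zero,
    hyperbolicSum_apply]
  simp

end Examples

end LinearMap.BilinForm
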